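import Literature.Probability.RandomPlanarGeometry.SAWMassNorm
import Literature.Probability.RandomPlanarGeometry.BDGS2012Prop13
import Mathlib.Analysis.Subadditive
import Mathlib.Topology.Algebra.Order.LiminfLimsup
import Mathlib.Topology.Algebra.InfiniteSum.ENNReal
import HarnessLib

/-!
# The mass of the self-avoiding walk (Madras–Slade 1993, §4.1) — proofs

Sibling proof file of `SAWMassNorm.lean` (objects `axisPoint d n = (n,0,…,0)`,
`mass d z = m(z)`, `bubble d z = B(z)`, and the named facts of Madras–Slade §4.1), on top of
`BDGS2012Prop13.lean` / `BDGS2012Proofs.lean` / `SAWCount.lean` (summability of `Σ cₙ zⁿ` below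
`z_c`, `cₙ(x) ≤ cₙ`, the straight walk). Everything here is PROVED. Source: N. Madras, G. Slade,
*The Self-Avoiding Walk*, Birkhäuser 1993, §4.1, book pp. 77–80 (held:
`lit read book:madras1993-self-avoiding-walk-pan10911251`, PDF pp. 66–69).

## Contents (namespace `Literature.Probability.RandomPlanarGeometry.SAW.Zd`)

* The two-point function below `z_c`: `hasSum_countAt_mul_pow` (`G_z(x) = Σₙ cₙ(x) zⁿ`,
  convergent), `twoPoint_le_susceptibility` (`G_z(0,x) ≤ χ(z)`), `one_le_countAt_axisPoint` (the straight walk), `twoPoint_axisPoint_pos`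
  (`G_z(0,(n,0)) ≥ zⁿ > 0`); `axisPoint` arithmetic.
* **`MadrasSlade1993_bubble_finite_holds`** — "the bubble diagram `B(z) = Σ_x G_z(0,x)²` is
  finite for `0 < z < z_c` (since `B(z) ≤ χ(z)²`)" (book p. 87 and §1.5): in `[0, ∞]`,
  `Σ_x G_z(x) = Σₙ cₙ zⁿ = χ(z)` (Tonelli, `Σ_x cₙ(x) = cₙ`), so `Σ_x G_z(x)² ≤ χ(z)·Σ_x G_z(x) < ∞`.
* **`MadrasSlade1993_lemma_4_1_4.thm_4_1_3a`** — the printed proof of **Theorem 4.1.3(a)** from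
  Lemma 4.1.4 (book p. 80): with `h_n = −log[G_z(0,(n,0))/B(z)]`, (4.1.5) at `x = (n,0)`,
  `y = (m+n,0)` divided by `B(z)²` makes `h` subadditive, so Fekete's lemma (Lemma 1.2.2 =
  Mathlib `Subadditive.tendsto_lim`; `h_n ≥ log B(z) − log χ(z)` from `G ≤ χ` bounds `h_n/n`
  below) gives `lim h_n/n = inf_{n ≥ 1} h_n/n`; since `(log B)/n → 0` the printed sequence
  `−n⁻¹ log G_z(0,(n,0))` has the same limit, which is therefore its liminf `m(z)`
  (`Filter.Tendsto.liminf_eq`), and (4.1.4) `G_z(0,(n,0)) ≤ B(z) e^{−m(z) n}` is `m ≤ h_n/n`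
  exponentiated.

## References

* N. Madras, G. Slade, *The Self-Avoiding Walk*, Birkhäuser 1993: §1.2 Lemma 1.2.2, §1.5,
  §4.1 (4.1.1), Theorem 4.1.3, Lemma 4.1.4 (4.1.5), proof of Theorem 4.1.3 (4.1.6), p. 87.
-/

noncomputable section

open Filter Finset Literature.Probability.LatticeModels Literature.Probability.Percolation
open scoped BigOperators Topology ENNReal

namespace Literature.Probability.RandomPlanarGeometry.SAW.Zd

variable {d : ℕ}

/-! ### The two-point function below `z_c` -/

/-- Below `z_c` the two-point function is an honest sum: `G_z(x) = Σₙ cₙ(x) zⁿ` with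
`Σₙ cₙ(x) zⁿ` convergent for `0 < z < z_c` (dominated by `χ(z) = Σₙ cₙ zⁿ`, `cₙ(x) ≤ cₙ`).
[cite: MadrasSlade1993, §1.3, eqs. (1.3.4)–(1.3.5)] -/
theorem hasSum_countAt_mul_pow {z : ℝ} (hz : 0 < z) (hzc : z < criticalPoint d) (x : Site d) :
    HasSum (fun n : ℕ => (countAt d n x : ℝ) * z ^ n) (twoPoint d 1 z x) := by
  have hs : Summable fun n : ℕ => (countAt d n x : ℝ) * z ^ n :=
    (summable_count_mul_pow hz hzc).of_nonneg_of_le (fun n => by positivity) fun n =>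
      mul_le_mul_of_nonneg_right (by exact_mod_cast countAt_le_count n x) (pow_nonneg hz.le n)
  simpa [twoPoint, weaklyCountAt_one] using hs.hasSum

/-- `G_z(0,x) ≤ χ(z)` for `0 < z < z_c` (termwise `cₙ(x) ≤ cₙ`).
[cite: MadrasSlade1993, §1.3, eq. (1.3.4)] -/
theorem twoPoint_le_susceptibility {z : ℝ} (hz : 0 < z) (hzc : z < criticalPoint d)
    (x : Site d) : twoPoint d 1 z x ≤ susceptibility d 1 z := by
  rw [← (hasSum_countAt_mul_pow hz hzc x).tsum_eq, susceptibility_one]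
  exact (hasSum_countAt_mul_pow hz hzc x).summable.tsum_le_tsum
    (fun n => mul_le_mul_of_nonneg_right (by exact_mod_cast countAt_le_count n x)
      (pow_nonneg hz.le n)) (summable_count_mul_pow hz hzc)

/-! ### Axis points -/

/-- `(a,0,…,0) - (b,0,…,0) = (a-b,0,…,0)`. [folklore] -/
theorem axisPoint_sub (a b : ℤ) : axisPoint d a - axisPoint d b = axisPoint d (a - b) := by
  funext i
  simp only [axisPoint, Pi.sub_apply]
  split_ifs <;> simp

/-- `(n+m,0) - (n,0) = (m,0)` for naturals `n, m`. [folklore] -/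
theorem axisPoint_natCast_add_sub (n m : ℕ) :
    axisPoint d ((n + m : ℕ) : ℤ) - axisPoint d (n : ℤ) = axisPoint d (m : ℤ) := by
  rw [axisPoint_sub]
  congr 1
  push_cast
  ring

/-- For `d ≥ 1` the axis point is the coordinate vector `n e₀`. [folklore] -/
theorem axisPoint_eq_single [NeZero d] (n : ℤ) : axisPoint d n = Pi.single (0 : Fin d) n := by
  funext i
  rw [axisPoint, Pi.single_apply]
  congr 1
  simp only [Fin.ext_iff, Fin.val_zero]

/-- `cₙ((n,0,…,0)) ≥ 1`: the straight walk `i ↦ i e₀`. [cite: MadrasSlade1993, §1.2] -/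
theorem one_le_countAt_axisPoint [NeZero d] (n : ℕ) : 1 ≤ countAt d n (axisPoint d n) := by
  rw [← card_sawFun]
  refine Finset.card_pos.2 ⟨straightWalk d n, ?_⟩
  rw [mem_sawFun_iff_mem_saws]
  refine ⟨straightWalk_mem_saws d n, ?_⟩
  rw [axisPoint_eq_single]
  simp [straightWalk]

/-- **`G_z(0,(n,0)) > 0`** for `0 < z < z_c` (indeed `≥ zⁿ`, the straight walk; (1.3.16)).
[cite: MadrasSlade1993, §1.3, eq. (1.3.16)] -/
theorem twoPoint_axisPoint_pos [NeZero d] {z : ℝ} (hz : 0 < z) (hzc : z < criticalPoint d)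
    (n : ℕ) : 0 < twoPoint d 1 z (axisPoint d n) := by
  have hs := hasSum_countAt_mul_pow hz hzc (axisPoint d n)
  rw [← hs.tsum_eq]
  calc (0 : ℝ) < z ^ n := pow_pos hz n
    _ ≤ (countAt d n (axisPoint d n) : ℝ) * z ^ n :=
        le_mul_of_one_le_left (pow_nonneg hz.le n) (by exact_mod_cast one_le_countAt_axisPoint n)
    _ ≤ ∑' k, (countAt d k (axisPoint d n) : ℝ) * z ^ k :=
        hs.summable.le_tsum n fun k _ => by positivity

/-! ### The bubble diagram is finite below `z_c` -/

/-- In `[0, ∞]`: `Σ_x Σₙ cₙ(x) tⁿ = Σₙ cₙ tⁿ` (Tonelli; `Σ_x cₙ(x) = cₙ`), i.e.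
`Σ_x G_z(0,x) = χ(z)` (1.3.4). [cite: MadrasSlade1993, §1.3, eq. (1.3.4)] -/
theorem ennreal_tsum_tsum_countAt_mul_pow (d : ℕ) (t : ℝ≥0∞) :
    ∑' x : Site d, ∑' n : ℕ, (countAt d n x : ℝ≥0∞) * t ^ n =
      ∑' n : ℕ, (count d n : ℝ≥0∞) * t ^ n := by
  classical
  rw [ENNReal.tsum_comm]
  refine tsum_congr fun n => ?_
  rw [ENNReal.tsum_mul_right]
  congr 1
  rw [tsum_eq_sum (s := box d n) fun x hx => by rw [countAt_eq_zero_of_not_mem_box hx, Nat.cast_zero],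
    count, Nat.cast_sum]

/-- Below `z_c`, `ofReal G_z(x) = Σₙ cₙ(x) (ofReal z)ⁿ` in `[0, ∞]`. [folklore] -/
theorem ofReal_twoPoint {z : ℝ} (hz : 0 < z) (hzc : z < criticalPoint d) (x : Site d) :
    ENNReal.ofReal (twoPoint d 1 z x) = ∑' n : ℕ, (countAt d n x : ℝ≥0∞) * ENNReal.ofReal z ^ n := by
  rw [← (hasSum_countAt_mul_pow hz hzc x).tsum_eq, ENNReal.ofReal_tsum_of_nonneg
    (fun n => by positivity) (hasSum_countAt_mul_pow hz hzc x).summable]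
  refine tsum_congr fun n => ?_
  rw [ENNReal.ofReal_mul (by positivity), ENNReal.ofReal_natCast, ENNReal.ofReal_pow hz.le]

/-- Below `z_c`, `Σₙ cₙ (ofReal z)ⁿ = ofReal χ(z) < ∞` in `[0, ∞]`. [cite: MadrasSlade1993, §1.3, eq. (1.3.5)] -/
theorem ennreal_tsum_count_mul_pow_eq_ofReal {z : ℝ} (hz : 0 < z) (hzc : z < criticalPoint d) :
    ∑' n : ℕ, (count d n : ℝ≥0∞) * ENNReal.ofReal z ^ n = ENNReal.ofReal (susceptibility d 1 z) := by
  rw [susceptibility_one, ENNReal.ofReal_tsum_of_nonneg (fun n => by positivity)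
    (summable_count_mul_pow hz hzc)]
  refine tsum_congr fun n => ?_
  rw [ENNReal.ofReal_mul (by positivity), ENNReal.ofReal_natCast, ENNReal.ofReal_pow hz.le]

/-- Below `z_c`, `Σ_x ofReal (G_z(0,x)²) ≤ ofReal χ(z)²` in `[0, ∞]`; in particular it is finite.
[cite: MadrasSlade1993, §1.5 and §4.1 p. 87 (`B(z) ≤ χ(z)²`)] -/
theorem ennreal_tsum_ofReal_twoPoint_sq_le {z : ℝ} (hz : 0 < z) (hzc : z < criticalPoint d) :
    ∑' x : Site d, ENNReal.ofReal (twoPoint d 1 z x ^ 2) ≤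
      ENNReal.ofReal (susceptibility d 1 z) ^ 2 := by
  have hsum : ∑' x : Site d, ENNReal.ofReal (twoPoint d 1 z x) =
      ENNReal.ofReal (susceptibility d 1 z) := by
    rw [← ennreal_tsum_count_mul_pow_eq_ofReal hz hzc, ← ennreal_tsum_tsum_countAt_mul_pow]
    exact tsum_congr fun x => ofReal_twoPoint hz hzc x
  calc ∑' x : Site d, ENNReal.ofReal (twoPoint d 1 z x ^ 2)
      = ∑' x : Site d, ENNReal.ofReal (twoPoint d 1 z x) * ENNReal.ofReal (twoPoint d 1 z x) := by
        refine tsum_congr fun x => ?_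
        rw [sq, ENNReal.ofReal_mul ((hasSum_countAt_mul_pow hz hzc x).nonneg fun n => by positivity)]
    _ ≤ ∑' x : Site d, ENNReal.ofReal (susceptibility d 1 z) * ENNReal.ofReal (twoPoint d 1 z x) := by
        refine ENNReal.tsum_le_tsum fun x => ?_
        gcongr
        exact twoPoint_le_susceptibility hz hzc x
    _ = ENNReal.ofReal (susceptibility d 1 z) ^ 2 := by
        rw [ENNReal.tsum_mul_left, hsum, sq]

/-- **Discharge of `MadrasSlade1993_bubble_finite`**: for `d ≥ 1` and `0 < z < z_c` the family
`x ↦ G_z(0,x)²` is summable over `ℤ^d` ("the bubble diagram `B(z)` is finite for `0 < z < z_c`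
(since `B(z) ≤ χ(z)²`)"). (The hypothesis `1 ≤ d` is not needed.)
[cite: MadrasSlade1993, §4.1, p. 87 (before Theorem 4.1.18); §1.5] -/
theorem MadrasSlade1993_bubble_finite_holds : MadrasSlade1993_bubble_finite := by
  intro d _ z hz hzc
  have hne : ∑' x : Site d, ENNReal.ofReal (twoPoint d 1 z x ^ 2) ≠ ∞ :=
    ne_top_of_le_ne_top (ENNReal.pow_ne_top ENNReal.ofReal_ne_top)
      (ennreal_tsum_ofReal_twoPoint_sq_le hz hzc)
  have := ENNReal.summable_toReal hne
  simpa only [ENNReal.toReal_ofReal (sq_nonneg _)] using this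

/-- Below `z_c` the bubble diagram is the honest sum: `ofReal B(z) = Σ_x (Σₙ cₙ(x) (ofReal z)ⁿ)²`
in `[0, ∞]`. [cite: MadrasSlade1993, §1.5, Definition 1.5.1] -/
theorem ofReal_bubble {z : ℝ} (hd : 1 ≤ d) (hz : 0 < z) (hzc : z < criticalPoint d) :
    ENNReal.ofReal (bubble d z) =
      ∑' x : Site d, (∑' n : ℕ, (countAt d n x : ℝ≥0∞) * ENNReal.ofReal z ^ n) ^ 2 := by
  rw [bubble, ENNReal.ofReal_tsum_of_nonneg (fun x => sq_nonneg _)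
    (MadrasSlade1993_bubble_finite_holds d hd z hz hzc)]
  refine tsum_congr fun x => ?_
  rw [ENNReal.ofReal_pow ((hasSum_countAt_mul_pow hz hzc x).nonneg fun n => by positivity),
    ofReal_twoPoint hz hzc]

/-- `B(z) ≥ 0`. [folklore] -/
theorem bubble_nonneg (d : ℕ) (z : ℝ) : 0 ≤ bubble d z :=
  tsum_nonneg fun _ => sq_nonneg _

/-! ### Theorem 4.1.3(a) from Lemma 4.1.4 -/

/-- **Theorem 4.1.3(a) from Lemma 4.1.4** — the printed proof (book p. 80): for `0 < z < z_c`
put `h_n = −log[G_z(0,(n,0))/B(z)]`; (4.1.5) with `x = (n,0)`, `y = (m+n,0)`, divided by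
`B(z)²`, says `h_{n+m} ≤ h_n + h_m`, so by Fekete's lemma (Lemma 1.2.2) `h_n/n → inf_{n≥1} h_n/n`
(the sequence `h_n/n` is bounded below because `G_z(0,x) ≤ χ(z)`); as `(log B(z))/n → 0`, the
sequence `−n⁻¹ log G_z(0,(n,0))` converges to the same limit, which is therefore its liminf
`m(z)`; and (4.1.4) is `m(z) ≤ h_n/n` exponentiated.
[cite: MadrasSlade1993, Theorem 4.1.3(a) and its proof, eq. (4.1.6)] -/
theorem MadrasSlade1993_lemma_4_1_4.thm_4_1_3a (hL : MadrasSlade1993_lemma_4_1_4) :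
    MadrasSlade1993_thm_4_1_3a := by
  intro d hd z hz hzc
  haveI : NeZero d := ⟨by omega⟩
  set G : ℕ → ℝ := fun n => twoPoint d 1 z (axisPoint d n) with hG
  set B : ℝ := bubble d z with hB
  have hGpos : ∀ n, 0 < G n := fun n => twoPoint_axisPoint_pos hz hzc n
  -- (4.1.5) along the first axis: `G(n) G(m) ≤ B G(n+m)`
  have hsuper : ∀ n m : ℕ, G n * G m ≤ B * G (n + m) := by
    intro n m
    have h := hL d hd z hz hzc (axisPoint d n) (axisPoint d (n + m : ℕ))
    rw [axisPoint_natCast_add_sub] at h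
    exact h
  have hBpos : 0 < B := by
    have h := hsuper 0 0
    rw [Nat.add_zero] at h
    exact (hGpos 0).trans_le (le_of_mul_le_mul_right h (hGpos 0))
  -- the subadditive sequence `h_n = -log [G(n)/B] = log B - log G(n)`
  set u : ℕ → ℝ := fun n => Real.log B - Real.log (G n) with hu
  have hsub : Subadditive u := by
    intro m n
    have hlog := Real.log_le_log (mul_pos (hGpos m) (hGpos n)) (hsuper m n)
    rw [Real.log_mul (hGpos m).ne' (hGpos n).ne', Real.log_mul hBpos.ne' (hGpos _).ne'] at hlog
    simp only [hu]
    linarith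
  -- bounded below: `G(n) ≤ χ(z)`
  set c : ℝ := Real.log B - Real.log (susceptibility d 1 z) with hc
  have hlow : ∀ n, c ≤ u n := fun n => by
    simp only [hu, hc]
    linarith [Real.log_le_log (hGpos n) (twoPoint_le_susceptibility hz hzc _)]
  have hbdd : BddBelow (Set.range fun n : ℕ => u n / n) := by
    refine ⟨min 0 c, ?_⟩
    rintro _ ⟨n, rfl⟩
    rcases Nat.eq_zero_or_pos n with rfl | hn
    · simp
    · have hn' : (0 : ℝ) < n := by exact_mod_cast hn
      rcases le_or_gt 0 c with h0c | hc0
      · exact (min_le_left _ _).trans (div_nonneg (h0c.trans (hlow n)) hn'.le)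
      · calc min 0 c ≤ c := min_le_right _ _
          _ ≤ c / n := by
            rw [le_div_iff₀ hn']
            have h1 : (1 : ℝ) ≤ n := by exact_mod_cast hn
            nlinarith
          _ ≤ u n / n := div_le_div_of_nonneg_right (hlow n) hn'.le
  have hlim := hsub.tendsto_lim hbdd
  -- `-log G(n) / n = u n / n - (log B) / n` has the same limit
  have hT : Tendsto (fun n : ℕ => -Real.log (G n) / (n : ℝ)) atTop (𝓝 hsub.lim) := by
    have h2 := hlim.sub (tendsto_const_div_atTop_nhds_zero_nat (Real.log B))
    rw [sub_zero] at h2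
    refine h2.congr' (Eventually.of_forall fun n => ?_)
    simp only [hu]
    ring
  have hmass : mass d z = hsub.lim := hT.liminf_eq
  refine ⟨by rw [hmass]; exact hT, ?_, fun n hn => ?_⟩
  · -- `m(z) = inf_{n ≥ 1} h_n / n`
    have hset : (Set.range fun n : {n : ℕ // 1 ≤ n} =>
        -Real.log (G n / B) / ((n : ℕ) : ℝ)) = (fun n : ℕ => u n / n) '' Set.Ici 1 := by
      ext t
      simp only [Set.mem_range, Set.mem_image, Set.mem_Ici, Subtype.exists, exists_prop]
      constructor
      · rintro ⟨n, hn, rfl⟩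
        refine ⟨n, hn, ?_⟩
        rw [hu, Real.log_div (hGpos n).ne' hBpos.ne']
        ring
      · rintro ⟨n, hn, rfl⟩
        refine ⟨n, hn, ?_⟩
        rw [hu, Real.log_div (hGpos n).ne' hBpos.ne']
        ring
    rw [hmass, hset, Subadditive.lim]
    exact isGLB_csInf ⟨_, Set.mem_image_of_mem _ (Set.mem_Ici.2 le_rfl)⟩
      (hbdd.mono (Set.image_subset_range _ _))
  · -- (4.1.4): `m(z) n ≤ h_n`, i.e. `G(n) ≤ B e^{-m(z) n}`
    have hn' : (0 : ℝ) < n := by exact_mod_cast hn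
    have hLn : hsub.lim ≤ u n / n := hsub.lim_le_div hbdd (by omega)
    rw [le_div_iff₀ hn'] at hLn
    simp only [hu] at hLn
    rw [hmass]
    calc G n = Real.exp (Real.log (G n)) := (Real.exp_log (hGpos n)).symm
      _ ≤ Real.exp (Real.log B - hsub.lim * n) := Real.exp_le_exp.2 (by linarith)
      _ = B * Real.exp (-(hsub.lim * n)) := by
          rw [sub_eq_add_neg, Real.exp_add, Real.exp_log hBpos]

end Literature.Probability.RandomPlanarGeometry.SAW.Zd
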